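import Mathlib
import HarnessLib
import Summits.Ventures.LatticeQCDFlow.Scaling.AutoregressiveGaugeColdEscapeSeparation
import Summits.Ventures.LatticeQCDFlow.Scaling.AutoregressiveGaugeUniformRateExact

/-!
# LatticeQCDFlow / Scaling — the exact cold escape rate of the optimal heat bath in the VOLUME: bounded below by
# `m/M` on `(ℤ/L)^2` for every `L`, exponentially small in `L^d` for `d ≥ 3`

HONEST FRAMING: exact (Metropolis-corrected) sampling algorithms for lattice gauge theory;
figures of merit are autocorrelation/cost numbers at stated couplings and volumes; no
continuum-physics claim.

Venture `LatticeQCDFlow` (cell pub-lqcd), topic `Scaling`, FANOUT row 30 (lean-1, GEN-28) — OUR WORK on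
THEORY-2.md §4 row C5.  `AutoregressiveGaugeHeatBathColdExact` ∕ `…UniformRateExact`: the uniform
convergence rate gap of the exact one-plaquette heat-bath sampler along a ranked `(B, t)` is EXACTLY its cold
escape probability `A(cold) = Z/(c^{#B} M^k)`, `k = #Bᶜ`.  Here that number is squeezed:

* §1 **`heatBath_cold_acceptMass_bounds`** — `(m/M)^k ≤ A(cold) ≤ 1` (`m^k Z_B ≤ Z ≤ M^k Z_B`);
* §2 **`heatBath_cold_acceptMass_le_eta`** — with a total closing map `u` of maximal rank:
  `A(cold) ≤ η = ∏_{a∈B} c_{n_a+1}/(c M^{n_a})` (`PlaquettePeelingClosingMap` ∕ `…ClosingMapFloor`: `Z/Z_B ≤ η M^k`)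
  — GEN-27's floor constant is an upper bound for the EXACT rate; and `η ≤ θ₁^{#u(Bᶜ)}`,
  `(2(d−1) − 1)·#u(Bᶜ) ≥ k` (`…ColdEscapeSeparation`);
* §3 THE DIMENSION DICHOTOMY for OPTIMAL structures (`k = k_min(d, L) = (d−1)(d−2)/2·L^d + (d−1)`):
  **`two_dim_heatBath_cold_acceptMass_ge`** — on `(ℤ/L)^2` (`k_min = 1`) `A(cold) ≥ m/M` for EVERY `L`, so
  (**`two_dim_heatBath_uniform_rate`**) `|μK^t(A) − π(A)| ≤ (1 − m/M)^t` uniformly in the volume — the exact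
  two-dimensional heat bath does not freeze; **`optimal_heatBath_cold_acceptMass_le_pow`** — in every
  dimension `A(cold) ≤ θ₁^s` with `(2(d−1) − 1)·s ≥ k_min(d, L)`, `θ₁ = c₂/(cM) < 1` for non-constant `w`:
  for `d ≥ 3` the exact uniform rate gap is exponentially small in `L^d`.

No `def`, no `sorry`, nothing cited as a fact beyond the tree.
-/

noncomputable section

namespace Summit.Ventures.LatticeQCDFlow.Theory2.Autoregressive

open MeasureTheory ProbabilityTheory Function Finset
open scoped ENNReal
open Literature.MathematicalPhysics.QuantumFieldTheory Literature.MathematicalPhysics.QuantumLattice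
open Summit.Ventures.LatticeQCDFlow.Exactness Summit.Ventures.LatticeQCDFlow.Scoring

variable {d L : ℕ} [NeZero L] {G : Type*} [Group G] [TopologicalSpace G] [IsTopologicalGroup G]
  [CompactSpace G] [SecondCountableTopology G] [MeasurableSpace G] [BorelSpace G]

/-- `m^k Z_B ≤ Z ≤ M^k Z_B` and `Z_B = c^{#B}`: the squeeze of the partition function by the covered one.
[ours] -/
theorem integral_prod_weight_bounds (hL : 2 ≤ L) {w : G → ℝ} (hw : Continuous w) {m M : ℝ} (hm0 : 0 < m)
    (hm : ∀ g, m ≤ w g) (hM : ∀ g, w g ≤ M)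
    (B : Finset (Plaquette d L)) (t : Plaquette d L → Edge d L)
    (ht : ∀ p ∈ B, t p ∈ ({(p.1, p.2.1.1), (p.1.shift p.2.1.1, p.2.1.2),
        (p.1.shift p.2.1.2, p.2.1.1), (p.1, p.2.1.2)} : Finset (Edge d L)))
    (rank : Plaquette d L → ℕ)
    (hrank : ∀ p ∈ B, ∀ p' ∈ B, p ≠ p' → t p ∈ ({(p'.1, p'.2.1.1), (p'.1.shift p'.2.1.1, p'.2.1.2),
        (p'.1.shift p'.2.1.2, p'.2.1.1), (p'.1, p'.2.1.2)} : Finset (Edge d L)) → rank p < rank p') :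
    m ^ (Finset.univ \ B).card * (∫ g, w g ∂(haarProbability G)) ^ B.card ≤
      (∫ V, ∏ p : Plaquette d L, w (plaquetteHolonomy V p.1 p.2.1.1 p.2.1.2)
        ∂(Measure.pi fun _ : Edge d L => haarProbability G)) ∧
    (∫ V, ∏ p : Plaquette d L, w (plaquetteHolonomy V p.1 p.2.1.1 p.2.1.2)
        ∂(Measure.pi fun _ : Edge d L => haarProbability G)) ≤
      M ^ (Finset.univ \ B).card * (∫ g, w g ∂(haarProbability G)) ^ B.card := by
  set Haar : Measure (GaugeConfig d L G) := Measure.pi fun _ : Edge d L => haarProbability G with hHaar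
  set FB : GaugeConfig d L G → ℝ := fun U => ∏ p ∈ B, w (plaquetteHolonomy U p.1 p.2.1.1 p.2.1.2) with hFB
  set FR : GaugeConfig d L G → ℝ := fun U => ∏ p ∈ Finset.univ \ B, w (plaquetteHolonomy U p.1 p.2.1.1 p.2.1.2)
    with hFR
  have hw0 : ∀ g, 0 < w g := fun g => hm0.trans_le (hm g)
  have hMpos : 0 < M := (hw0 1).trans_le (hM 1)
  haveI : IsProbabilityMeasure Haar := by rw [hHaar]; infer_instance
  have hFBc : Continuous FB := continuous_prodPlaquetteWeight_anyDim hw B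
  have hFBpos : ∀ U, 0 < FB U := fun U => prod_pos fun p _ => hw0 _
  have hFRpos : ∀ U, 0 < FR U := fun U => prod_pos fun p _ => hw0 _
  have hFRle : ∀ U, FR U ≤ M ^ (Finset.univ \ B).card := fun U =>
    (pow_le_prodPlaquetteWeight_le_pow_anyDim hm0 hm hM _ U).2
  have hFRge : ∀ U, m ^ (Finset.univ \ B).card ≤ FR U := fun U =>
    (pow_le_prodPlaquetteWeight_le_pow_anyDim hm0 hm hM _ U).1
  have hsplit : ∀ U, (∏ p : Plaquette d L, w (plaquetteHolonomy U p.1 p.2.1.1 p.2.1.2)) = FR U * FB U := fun U =>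
    (Finset.prod_sdiff (Finset.subset_univ B)).symm
  have hFBi : Integrable FB Haar := by
    refine Integrable.mono' (integrable_const (M ^ B.card)) hFBc.aestronglyMeasurable (ae_of_all _ fun U => ?_)
    rw [Real.norm_eq_abs, abs_of_pos (hFBpos U)]
    exact (pow_le_prodPlaquetteWeight_le_pow_anyDim hm0 hm hM _ U).2
  have hZB : ∫ V, FB V ∂Haar = (∫ g, w g ∂(haarProbability G)) ^ B.card :=
    integral_prod_weight_eq_pow_of_rank (G := G) hL hw hm0 hm hM B t ht rank hrank
  simp_rw [hsplit]
  constructor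
  · rw [← hZB, ← integral_const_mul]
    exact integral_mono (hFBi.const_mul _) ((hFBi.const_mul (M ^ (Finset.univ \ B).card)).mono'
        ((continuous_prodPlaquetteWeight_anyDim hw (Finset.univ \ B)).mul hFBc).aestronglyMeasurable
        (ae_of_all _ fun U => by
          rw [Real.norm_eq_abs, abs_of_pos (mul_pos (hFRpos U) (hFBpos U))]
          exact mul_le_mul_of_nonneg_right (hFRle U) (hFBpos U).le))
      fun U => mul_le_mul_of_nonneg_right (hFRge U) (hFBpos U).le
  · rw [← hZB, ← integral_const_mul]
    exact integral_mono ((hFBi.const_mul (M ^ (Finset.univ \ B).card)).mono'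
        ((continuous_prodPlaquetteWeight_anyDim hw (Finset.univ \ B)).mul hFBc).aestronglyMeasurable
        (ae_of_all _ fun U => by
          rw [Real.norm_eq_abs, abs_of_pos (mul_pos (hFRpos U) (hFBpos U))]
          exact mul_le_mul_of_nonneg_right (hFRle U) (hFBpos U).le))
      (hFBi.const_mul _) fun U => mul_le_mul_of_nonneg_right (hFRle U) (hFBpos U).le

/-- **`(m/M)^k ≤ Z/(c^{#B} M^k) ≤ 1`**: the exact cold escape rate of the heat bath is squeezed by the weight
bounds. [ours] -/
theorem heatBath_coldRate_bounds (hL : 2 ≤ L) {w : G → ℝ} (hw : Continuous w) {m M : ℝ} (hm0 : 0 < m)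
    (hm : ∀ g, m ≤ w g) (hM : ∀ g, w g ≤ M)
    (B : Finset (Plaquette d L)) (t : Plaquette d L → Edge d L)
    (ht : ∀ p ∈ B, t p ∈ ({(p.1, p.2.1.1), (p.1.shift p.2.1.1, p.2.1.2),
        (p.1.shift p.2.1.2, p.2.1.1), (p.1, p.2.1.2)} : Finset (Edge d L)))
    (rank : Plaquette d L → ℕ)
    (hrank : ∀ p ∈ B, ∀ p' ∈ B, p ≠ p' → t p ∈ ({(p'.1, p'.2.1.1), (p'.1.shift p'.2.1.1, p'.2.1.2),
        (p'.1.shift p'.2.1.2, p'.2.1.1), (p'.1, p'.2.1.2)} : Finset (Edge d L)) → rank p < rank p') :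
    (m / M) ^ (Finset.univ \ B).card ≤
      (∫ V, ∏ p : Plaquette d L, w (plaquetteHolonomy V p.1 p.2.1.1 p.2.1.2)
          ∂(Measure.pi fun _ : Edge d L => haarProbability G)) /
        ((∫ g, w g ∂(haarProbability G)) ^ B.card * M ^ (Finset.univ \ B).card) ∧
    (∫ V, ∏ p : Plaquette d L, w (plaquetteHolonomy V p.1 p.2.1.1 p.2.1.2)
          ∂(Measure.pi fun _ : Edge d L => haarProbability G)) /
        ((∫ g, w g ∂(haarProbability G)) ^ B.card * M ^ (Finset.univ \ B).card) ≤ 1 := by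
  have hw0 : ∀ g, 0 < w g := fun g => hm0.trans_le (hm g)
  have hMpos : 0 < M := (hw0 1).trans_le (hM 1)
  have hc : 0 < ∫ g, w g ∂(haarProbability G) := haarProbability_integral_pos_of_continuous_pos hw hw0
  obtain ⟨hlo, hhi⟩ := integral_prod_weight_bounds hL hw hm0 hm hM B t ht rank hrank
  have hden : 0 < (∫ g, w g ∂(haarProbability G)) ^ B.card * M ^ (Finset.univ \ B).card :=
    mul_pos (pow_pos hc _) (pow_pos hMpos _)
  constructor
  · rw [div_pow, div_le_div_iff₀ (pow_pos hMpos _) hden]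
    calc m ^ (Finset.univ \ B).card * ((∫ g, w g ∂(haarProbability G)) ^ B.card * M ^ (Finset.univ \ B).card)
        = (m ^ (Finset.univ \ B).card * (∫ g, w g ∂(haarProbability G)) ^ B.card) * M ^ (Finset.univ \ B).card := by
          ring
      _ ≤ _ := mul_le_mul_of_nonneg_right hlo (pow_nonneg hMpos.le _)
  · rw [div_le_one hden, mul_comm]
    exact hhi

/-- **`Z/(c^{#B} M^k) ≤ η`** for a total closing map of maximal rank (`η = ∏_{a∈B} c_{n_a+1}/(c M^{n_a})`, GEN-27's
floor constant): the exact cold escape rate is what the closing map estimates. [ours] -/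
theorem heatBath_coldRate_le_eta (hL : 2 ≤ L) {w : G → ℝ} (hw : Continuous w) {m M : ℝ} (hm0 : 0 < m)
    (hm : ∀ g, m ≤ w g) (hM : ∀ g, w g ≤ M)
    (B : Finset (Plaquette d L)) (t : Plaquette d L → Edge d L)
    (ht : ∀ p ∈ B, t p ∈ ({(p.1, p.2.1.1), (p.1.shift p.2.1.1, p.2.1.2),
        (p.1.shift p.2.1.2, p.2.1.1), (p.1, p.2.1.2)} : Finset (Edge d L)))
    (rank : Plaquette d L → ℕ)
    (hrank : ∀ p ∈ B, ∀ p' ∈ B, p ≠ p' → t p ∈ ({(p'.1, p'.2.1.1), (p'.1.shift p'.2.1.1, p'.2.1.2),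
        (p'.1.shift p'.2.1.2, p'.2.1.1), (p'.1, p'.2.1.2)} : Finset (Edge d L)) → rank p < rank p')
    (u : Plaquette d L → Plaquette d L) (huB : ∀ p' ∈ Finset.univ \ B, u p' ∈ B)
    (hut : ∀ p' ∈ Finset.univ \ B, t (u p') ∈ ({(p'.1, p'.2.1.1), (p'.1.shift p'.2.1.1, p'.2.1.2),
        (p'.1.shift p'.2.1.2, p'.2.1.1), (p'.1, p'.2.1.2)} : Finset (Edge d L)))
    (humax : ∀ p' ∈ Finset.univ \ B, ∀ p ∈ B, p ≠ u p' → t p ∈ ({(p'.1, p'.2.1.1), (p'.1.shift p'.2.1.1, p'.2.1.2),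
        (p'.1.shift p'.2.1.2, p'.2.1.1), (p'.1, p'.2.1.2)} : Finset (Edge d L)) → rank p < rank (u p')) :
    (∫ V, ∏ p : Plaquette d L, w (plaquetteHolonomy V p.1 p.2.1.1 p.2.1.2)
          ∂(Measure.pi fun _ : Edge d L => haarProbability G)) /
        ((∫ g, w g ∂(haarProbability G)) ^ B.card * M ^ (Finset.univ \ B).card) ≤
      ∏ a ∈ B, (∫ h, w h ^ (((Finset.univ \ B).filter (fun p' => u p' = a)).card + 1) ∂(haarProbability G)) /
        ((∫ g, w g ∂(haarProbability G)) * M ^ ((Finset.univ \ B).filter (fun p' => u p' = a)).card) := by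
  have hw0 : ∀ g, 0 < w g := fun g => hm0.trans_le (hm g)
  have hMpos : 0 < M := (hw0 1).trans_le (hM 1)
  have hc : 0 < ∫ g, w g ∂(haarProbability G) := haarProbability_integral_pos_of_continuous_pos hw hw0
  have h := integral_prod_weight_div_le_of_totalClosingMap (G := G) hL hw hm0 hm hM B t ht rank hrank u huB hut humax
  rw [integral_prod_weight_eq_pow_of_rank (G := G) hL hw hm0 hm hM B t ht rank hrank] at h
  rw [← div_div, div_le_iff₀ (pow_pos hMpos _)]
  exact h

/-- **TWO DIMENSIONS: `A(cold) ≥ m/M` for every `L`** along an optimal structure of `(ℤ/L)^2` (`k_min(2, L) = 1`).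
[ours] -/
theorem two_dim_heatBath_coldRate_ge (hL : 2 ≤ L) {w : G → ℝ} (hw : Continuous w) {m M : ℝ} (hm0 : 0 < m)
    (hm : ∀ g, m ≤ w g) (hM : ∀ g, w g ≤ M)
    (B : Finset (Plaquette 2 L)) (t : Plaquette 2 L → Edge 2 L)
    (ht : ∀ p ∈ B, t p ∈ ({(p.1, p.2.1.1), (p.1.shift p.2.1.1, p.2.1.2),
        (p.1.shift p.2.1.2, p.2.1.1), (p.1, p.2.1.2)} : Finset (Edge 2 L)))
    (rank : Plaquette 2 L → ℕ)
    (hrank : ∀ p ∈ B, ∀ p' ∈ B, p ≠ p' → t p ∈ ({(p'.1, p'.2.1.1), (p'.1.shift p'.2.1.1, p'.2.1.2),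
        (p'.1.shift p'.2.1.2, p'.2.1.1), (p'.1, p'.2.1.2)} : Finset (Edge 2 L)) → rank p < rank p')
    (hopt : (Finset.univ \ B).card = 1) :
    m / M ≤ (∫ V, ∏ p : Plaquette 2 L, w (plaquetteHolonomy V p.1 p.2.1.1 p.2.1.2)
          ∂(Measure.pi fun _ : Edge 2 L => haarProbability G)) /
        ((∫ g, w g ∂(haarProbability G)) ^ B.card * M ^ (Finset.univ \ B).card) := by
  have h := (heatBath_coldRate_bounds hL hw hm0 hm hM B t ht rank hrank).1
  rw [hopt] at h ⊢
  simp only [pow_one] at h ⊢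
  exact h

/-- **TWO DIMENSIONS: THE EXACT HEAT BATH DOES NOT FREEZE** — along an optimal structure of `(ℤ/L)^2`
(`w(1) = M`), for every initial law, event and time `|μK^t(A) − π(A)| ≤ (1 − m/M)^t`, uniformly in `L`. [ours] -/
theorem two_dim_heatBath_uniform_rate (hL : 2 ≤ L) {w : G → ℝ} (hw : Continuous w) {m M : ℝ} (hm0 : 0 < m)
    (hm : ∀ g, m ≤ w g) (hM : ∀ g, w g ≤ M) (hw1 : w 1 = M)
    (B : Finset (Plaquette 2 L)) (t : Plaquette 2 L → Edge 2 L)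
    (ht : ∀ p ∈ B, t p ∈ ({(p.1, p.2.1.1), (p.1.shift p.2.1.1, p.2.1.2),
        (p.1.shift p.2.1.2, p.2.1.1), (p.1, p.2.1.2)} : Finset (Edge 2 L)))
    (rank : Plaquette 2 L → ℕ)
    (hrank : ∀ p ∈ B, ∀ p' ∈ B, p ≠ p' → t p ∈ ({(p'.1, p'.2.1.1), (p'.1.shift p'.2.1.1, p'.2.1.2),
        (p'.1.shift p'.2.1.2, p'.2.1.1), (p'.1, p'.2.1.2)} : Finset (Edge 2 L)) → rank p < rank p')
    (hopt : (Finset.univ \ B).card = 1)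
    (π q : Measure (GaugeConfig 2 L G)) [IsProbabilityMeasure π] [IsProbabilityMeasure q]
    (hπ : π = (Measure.pi fun _ : Edge 2 L => haarProbability G).withDensity fun U =>
      ENNReal.ofReal ((∏ p : Plaquette 2 L, w (plaquetteHolonomy U p.1 p.2.1.1 p.2.1.2)) /
        ∫ V, ∏ p : Plaquette 2 L, w (plaquetteHolonomy V p.1 p.2.1.1 p.2.1.2)
          ∂(Measure.pi fun _ : Edge 2 L => haarProbability G)))
    (hq : q = (Measure.pi fun _ : Edge 2 L => haarProbability G).withDensity fun U =>
      ENNReal.ofReal ((∏ p ∈ B, w (plaquetteHolonomy U p.1 p.2.1.1 p.2.1.2)) /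
        ∫ V, ∏ p ∈ B, w (plaquetteHolonomy V p.1 p.2.1.1 p.2.1.2)
          ∂(Measure.pi fun _ : Edge 2 L => haarProbability G)))
    (μ : Measure (GaugeConfig 2 L G)) [IsProbabilityMeasure μ] (n : ℕ) (A : Set (GaugeConfig 2 L G)) :
    |((fun ν : Measure (GaugeConfig 2 L G) => ν.bind (indepMH q fun U =>
        ((∫ V, ∏ p : Plaquette 2 L, w (plaquetteHolonomy V p.1 p.2.1.1 p.2.1.2)
            ∂(Measure.pi fun _ : Edge 2 L => haarProbability G)) /
          ((∫ V, ∏ p ∈ B, w (plaquetteHolonomy V p.1 p.2.1.1 p.2.1.2)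
            ∂(Measure.pi fun _ : Edge 2 L => haarProbability G)) *
            ∏ p ∈ Finset.univ \ B, w (plaquetteHolonomy U p.1 p.2.1.1 p.2.1.2)))⁻¹))^[n] μ).real A -
        π.real A| ≤ (1 - m / M) ^ n := by
  have hw0 : ∀ g, 0 < w g := fun g => hm0.trans_le (hm g)
  have hMpos : 0 < M := (hw0 1).trans_le (hM 1)
  have hrate := heatBath_uniform_rate hL hw hm0 hm hM hw1 B t ht rank hrank π q hπ hq μ n A
  have hge := two_dim_heatBath_coldRate_ge hL hw hm0 hm hM B t ht rank hrank hopt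
  have hle1 := (heatBath_coldRate_bounds hL hw hm0 hm hM B t ht rank hrank).2
  refine hrate.trans (pow_le_pow_left₀ (sub_nonneg.2 hle1) (by linarith) n)

/-- **EVERY DIMENSION: ALONG AN OPTIMAL STRUCTURE `A(cold) ≤ θ₁^s` WITH `(2(d−1) − 1)·s ≥ k_min(d, L)`**,
`θ₁ = c₂/(cM)` (`< 1` for non-constant `w`): for `d ≥ 3` the exact uniform rate gap of the heat bath is
exponentially small in the volume. [ours] -/
theorem optimal_heatBath_coldRate_le_pow (hL : 2 ≤ L) {w : G → ℝ} (hw : Continuous w) {m M : ℝ} (hm0 : 0 < m)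
    (hm : ∀ g, m ≤ w g) (hM : ∀ g, w g ≤ M)
    (B : Finset (Plaquette d L)) (t : Plaquette d L → Edge d L)
    (ht : ∀ p ∈ B, t p ∈ ({(p.1, p.2.1.1), (p.1.shift p.2.1.1, p.2.1.2),
        (p.1.shift p.2.1.2, p.2.1.1), (p.1, p.2.1.2)} : Finset (Edge d L)))
    (rank : Plaquette d L → ℕ)
    (hrank : ∀ p ∈ B, ∀ p' ∈ B, p ≠ p' → t p ∈ ({(p'.1, p'.2.1.1), (p'.1.shift p'.2.1.1, p'.2.1.2),
        (p'.1.shift p'.2.1.2, p'.2.1.1), (p'.1, p'.2.1.2)} : Finset (Edge d L)) → rank p < rank p')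
    (hopt : (Finset.univ \ B).card = (d - 1) * (d - 2) / 2 * L ^ d + (d - 1)) :
    ∃ s : ℕ, (d - 1) * (d - 2) / 2 * L ^ d + (d - 1) ≤ (2 * (d - 1) - 1) * s ∧
      (∫ V, ∏ p : Plaquette d L, w (plaquetteHolonomy V p.1 p.2.1.1 p.2.1.2)
            ∂(Measure.pi fun _ : Edge d L => haarProbability G)) /
          ((∫ g, w g ∂(haarProbability G)) ^ B.card * M ^ (Finset.univ \ B).card) ≤
        ((∫ h, w h ^ 2 ∂(haarProbability G)) / ((∫ g, w g ∂(haarProbability G)) * M)) ^ s := by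
  have hw0 : ∀ g, 0 < w g := fun g => hm0.trans_le (hm g)
  obtain ⟨rank', u, hrank', huB, hut, humax⟩ := exists_closingMap_of_optimal hL B t ht rank hrank hopt
  obtain ⟨hη, hk⟩ := eta_le_twoWeight_pow_closers (G := G) hw hw0 hM B t ht u huB hut
  refine ⟨((Finset.univ \ B).image u).card, hopt ▸ hk, ?_⟩
  exact (heatBath_coldRate_le_eta hL hw hm0 hm hM B t ht rank' hrank' u huB hut humax).trans hη

end Summit.Ventures.LatticeQCDFlow.Theory2.Autoregressive

end
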